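import Literature.AnabelianGeometry.SemiGraphs.CoveringCellsGaloisAction
import Literature.AnabelianGeometry.SemiGraphs.SemiGraphNonSeparatingCells
import Literature.AnabelianGeometry.SemiGraphs.GraphOfAnabelioidsGalois
import HarnessLib

/-!
# PORT PRODUCTION, stage 1: a Galois level with double incidence on both sides of an edge-cell of `𝔾_A`
# carries a non-separating cell over it ([SemiAnbd] Def. 2.2 (i) p. 23, proof of Cor. 2.7 (i) p. 30)

Mochizuki, *Semi-graphs of anabelioids*, Publ. RIMS **42** (2006), §2: Def. 2.2 (i) p. 23 (the covering
semi-graph `𝔾_A`: cells = connected components) and the proof of Cor. 2.7 (i) p. 30 ("[as one verifies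
immediately] `ℋ′` injects into `𝒢′` as a subgraph") [cite: MochizukiSemiAnbd2006, Cor. 2.7(i) p.30].
PROOF-ONLY (abc-iut cell, layer L3; FACT-LIST row F-1487 `covering_subgraphComponents_doubleCosets` AS TYPED,
CLASS route, brick R6a PORT PRODUCTION, STAGE 1; seat abc-iut-f-161 gen 12; L3-lead ε45–ε47).  No
definition, no instance, no named fact.  Over `CoveringCellsGaloisAction` (bricks (a), (b)) and
`SemiGraphNonSeparatingCells` (brick (c)): `total_abuts_cellMap`, `cellMap_branch_injective`, `cellMap_over`
read (a)/(b) on the covering semi-graph `𝔾_Y = Y.fibreData.total` (maps induced by `τ : Y → Y′` on cells,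
`Shrink` bookkeeping); `port_of_isGalois_of_doubleIncidence` is **STAGE 1 OF PORT PRODUCTION**: for `𝒢`
connected, `Y` GALOIS in `B(𝒢)`, `g : Y → A`, an edge-cell `(e, Q)` of `𝔾_A` and four branch-cells of
`𝔾_Y` over `(e, Q)` — `β₀ ≠ β₀′` with the same abutment, `β₁ ≠ β₁′` with the same abutment, `β₀`, `β₁`
over the two different branches of `e` — the PORT clause of
`covering_subgraphComponents_doubleCosets_of_connectedPorts` (`SubgraphComponentsDoubleCosetsOfPorts.lean`)
holds at `(e, Q)` with this `Y`: `β₀` is two-sided, NON-SEPARATING in `𝔾_Y`, and lies over `Q`.  Not here: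
producing such a level from «essential on both sides» (brick (d)), the localised tie (R6c), hair (R7).
CLASS route only: F-1487 AS TYPED is not asserted; nothing here takes a side on [IUTchIII] Cor. 3.12.
-/

namespace Literature.AnabelianGeometry.SemiGraphs.SemiGraphOfAnabelioids.BObj

open CategoryTheory CategoryTheory.Limits CategoryTheory.PreGaloisCategory
open Literature.AnabelianGeometry.Anabelioids

universe v₁ u₁ u

set_option backward.isDefEq.respectTransparency false -- `π₀Obj` coercions, as in `ComponentsReadBack.lean`

variable {𝒢 : SemiGraphOfAnabelioids.{v₁, u₁, u}}

/-- The branches of the edge of `b` are `b` and any `b₁ ≠ b` on it. [cite: MochizukiSemiAnbd2006, §1 p.11] -/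
private theorem base_eq_or_eq {b b₁ b' : 𝒢.graph.Branch} (hne : b₁ ≠ b)
    (he : 𝒢.graph.edgeOf b₁ = 𝒢.graph.edgeOf b) (hb : 𝒢.graph.edgeOf b' = 𝒢.graph.edgeOf b) :
    b' = b ∨ b' = b₁ := by
  obtain ⟨c₁, c₂, h12, h₁, h₂, hall⟩ := 𝒢.graph.two_branches (𝒢.graph.edgeOf b)
  rcases hall b rfl with rfl | rfl <;> rcases hall b₁ he with h | h <;>
    rcases hall b' hb with h' | h' <;> subst_vars <;> simp_all

variable (Y : 𝒢.BObj)

/-- **The cell map respects abutment** (brick (a) read on `𝔾`): if `β` abuts to `x` in `𝔾_Y` then the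
image branch-cell of `β` under `τ : Y → Y′` abuts to the image vertex-cell of `x` in `𝔾_{Y′}`.
[cite: MochizukiSemiAnbd2006, Def. 2.2(i) p.23] -/
theorem total_abuts_cellMap {Y' : 𝒢.BObj} (τ : Y ⟶ Y') (β : Y.fibreData.total.Branch)
    (x : Y.fibreData.total.Vertex) (hx : Y.fibreData.total.abuts β = some x) :
    Y'.fibreData.total.abuts ⟨β.1, equivShrink _ (componentUnder (τ.fT (𝒢.graph.edgeOf β.1)) (Y.brComp β))⟩ =
      some ⟨x.1, equivShrink _ (componentUnder (τ.fS x.1) (Y.vComp x))⟩ := by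
  have h : 𝒢.graph.abuts β.1 = some x.1 := abuts_fst hx
  have hv : Y.vComp x = Y.componentOver β.1 x.1 h (Y.brComp β) := vComp_eq_componentOver hx
  have := coveringGraph_abuts_mk Y' β.1 h (componentUnder (τ.fT (𝒢.graph.edgeOf β.1)) (Y.brComp β))
  change Y'.fibreData.total.abuts _ = _ at this
  rw [this, componentOver_componentUnder, ← hv]

/-- The cell map of an isomorphism is injective on branch-cells. [cite: MochizukiSemiAnbd2006, Def. 2.2(i) p.23] -/
theorem cellMap_branch_injective {Y' : 𝒢.BObj} (τ : Y ⟶ Y') [IsIso τ] :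
    Function.Injective (fun β : Y.fibreData.total.Branch => (⟨β.1, equivShrink _
      (componentUnder (τ.fT (𝒢.graph.edgeOf β.1)) (Y.brComp β))⟩ : Y'.fibreData.total.Branch)) := by
  rintro ⟨b, c⟩ ⟨b', c'⟩ hββ'
  obtain ⟨rfl, hc⟩ := Sigma.mk.inj_iff.mp hββ'
  haveI : IsIso (τ.fT (𝒢.graph.edgeOf b)) := by change IsIso ((𝒢.ρE (𝒢.graph.edgeOf b)).map τ); infer_instance
  have := componentUnder_injective_of_isIso (τ.fT (𝒢.graph.edgeOf b))
    ((equivShrink _).injective (eq_of_heq hc))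
  change (equivShrink _).symm c = (equivShrink _).symm c' at this
  rw [(equivShrink _).symm.injective this]

/-- Over `A`, the cell map of `τ` with `τ ≫ g = g` preserves "lying over the cell `(e, Q)` of `𝔾_A`".
[cite: MochizukiSemiAnbd2006, Def. 2.2(i) p.23] -/
theorem cellMap_over {A : 𝒢.BObj} (g : Y ⟶ A) (τ : Y ⟶ Y) (hτ : τ ≫ g = g) (β : Y.fibreData.total.Branch) :
    componentUnder (g.fT (𝒢.graph.edgeOf β.1))
        (Y.brComp ⟨β.1, equivShrink _ (componentUnder (τ.fT (𝒢.graph.edgeOf β.1)) (Y.brComp β))⟩) =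
      componentUnder (g.fT (𝒢.graph.edgeOf β.1)) (Y.brComp β) := by
  change componentUnder _ ((equivShrink _).symm (equivShrink _ _)) = _
  rw [Equiv.symm_apply_apply, ← componentUnder_comp, ← comp_fT, hτ]

/-- **STAGE 1 OF PORT PRODUCTION — double incidence on both sides at a Galois level gives a PORT**
([SemiAnbd] proof of Cor. 2.7 (i) p. 30, at OUR covering semi-graphs).  `𝒢` connected, `Y` Galois in
`B(𝒢)`, `g : Y → A`, `(e, Q)` an edge-cell of `𝔾_A`; `β₀ ≠ β₀′` branch-cells of `𝔾_Y` with the SAME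
abutment, `β₁ ≠ β₁′` likewise, `β₀` and `β₁` over the two different branches of `e`, all four over `(e, Q)`.
Then the PORT clause of `covering_subgraphComponents_doubleCosets_of_connectedPorts` holds at `(e, Q)`:
`β₀` is two-sided, NON-SEPARATING in `𝔾_Y`, and lies over `Q` (`Aut_A(Y)` acts on `𝔾_Y` compatibly with
abutment (a), transitively on the cells over `(e, Q)` (b), so every end of such a cell carries two of them
and brick (c) applies).  Producing such a level is NOT addressed. [cite: MochizukiSemiAnbd2006, Cor. 2.7(i) p.30] -/
theorem port_of_isGalois_of_doubleIncidence [GaloisCategory 𝒢.BObj] (h𝒢 : 𝒢.IsConnected)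
    (A : 𝒢.BObj) (e : 𝒢.graph.Edge) (Q : π₀Obj (A.T e)) {Y : 𝒢.BObj} [IsGalois Y] (g : Y ⟶ A)
    (β₀ β₀' β₁ β₁' : Y.fibreData.total.Branch)
    (hb : Y.fibreData.proj.branchMap β₀ ≠ Y.fibreData.proj.branchMap β₁)
    (hne₀ : β₀' ≠ β₀) (hne₁ : β₁' ≠ β₁)
    (ha₀ : (Y.fibreData.total.abuts β₀).isSome)
    (ha₀' : Y.fibreData.total.abuts β₀' = Y.fibreData.total.abuts β₀)
    (ha₁ : (Y.fibreData.total.abuts β₁).isSome)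
    (ha₁' : Y.fibreData.total.abuts β₁' = Y.fibreData.total.abuts β₁)
    (hQ : ∀ β ∈ [β₀, β₀', β₁, β₁'],
      (⟨𝒢.graph.edgeOf (Y.fibreData.proj.branchMap β),
          componentUnder (g.fT (𝒢.graph.edgeOf (Y.fibreData.proj.branchMap β))) (Y.brComp β)⟩ :
        Σ e, π₀Obj (A.T e)) = ⟨e, Q⟩) :
    ∃ (Y : 𝒢.BObj) (_ : PreGaloisCategory.IsConnected Y) (g : Y ⟶ A)
      (bc : Y.fibreData.total.Branch) (vc₀ vc₁ : Y.fibreData.total.Vertex)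
      (bc₁ : Y.fibreData.total.Branch),
      Y.fibreData.total.abuts bc = some vc₀ ∧ Y.fibreData.total.abuts bc₁ = some vc₁ ∧
      bc₁ ≠ bc ∧ Y.fibreData.total.edgeOf bc₁ = Y.fibreData.total.edgeOf bc ∧
      Relation.ReflTransGen
        (fun x y : Y.fibreData.total.Vertex => ∃ b b' : Y.fibreData.total.Branch,
          b ≠ bc ∧ b' ≠ bc ∧ Y.fibreData.total.edgeOf b = Y.fibreData.total.edgeOf b' ∧
            Y.fibreData.total.abuts b = some x ∧ Y.fibreData.total.abuts b' = some y) vc₀ vc₁ ∧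
      ∃ (Q' : π₀Obj (A.T (𝒢.graph.edgeOf (Y.fibreData.proj.branchMap bc)))),
        (⟨𝒢.graph.edgeOf (Y.fibreData.proj.branchMap bc), Q'⟩ : Σ e, π₀Obj (A.T e)) = ⟨e, Q⟩ ∧
        ∃ k : ((Y.brComp bc).1 : 𝒢.E (𝒢.graph.edgeOf (Y.fibreData.proj.branchMap bc))) ⟶
            (Q'.1 : 𝒢.E (𝒢.graph.edgeOf (Y.fibreData.proj.branchMap bc))),
          k ≫ Q'.1.arrow = (Y.brComp bc).1.arrow ≫ g.fT (𝒢.graph.edgeOf (Y.fibreData.proj.branchMap bc)) := by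
  classical
  let P : Y.fibreData.total.Edge → Prop := fun ec =>
    (⟨ec.1, componentUnder (g.fT ec.1) (Y.eComp ec)⟩ : Σ e, π₀Obj (A.T e)) = ⟨e, Q⟩
  have hP₀ : P (Y.fibreData.total.edgeOf β₀) := hQ β₀ (by simp)
  have hP₀' : P (Y.fibreData.total.edgeOf β₀') := hQ β₀' (by simp)
  have hP₁ : P (Y.fibreData.total.edgeOf β₁) := hQ β₁ (by simp)
  have hP₁' : P (Y.fibreData.total.edgeOf β₁') := hQ β₁' (by simp)
  have he₀ : 𝒢.graph.edgeOf β₀.1 = e := congrArg Sigma.fst hP₀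
  change β₀.1 ≠ β₁.1 at hb
  have hbase : ∀ β : Y.fibreData.total.Branch, P (Y.fibreData.total.edgeOf β) → β.1 = β₀.1 ∨ β.1 = β₁.1 :=
    fun β hβ => base_eq_or_eq hb.symm ((congrArg Sigma.fst hP₁ :).trans he₀.symm)
      ((congrArg Sigma.fst hβ).trans he₀.symm)
  obtain ⟨⟨x₀, hx₀⟩, ⟨x₁, hx₁⟩⟩ := And.intro (Option.isSome_iff_exists.mp ha₀) (Option.isSome_iff_exists.mp ha₁)
  have hPabuts : ∀ β : Y.fibreData.total.Branch, P (Y.fibreData.total.edgeOf β) →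
      ∃ x, Y.fibreData.total.abuts β = some x := fun β hβ => by
    apply Option.isSome_iff_exists.mp
    rw [Y.fibreData.total_abuts_isSome]
    rcases hbase β hβ with h | h <;> rw [h]
    · rw [← Y.fibreData.total_abuts_isSome β₀]; exact ha₀
    · rw [← Y.fibreData.total_abuts_isSome β₁]; exact ha₁
  let fV : (Y ⟶ Y) → Y.fibreData.total.Vertex → Y.fibreData.total.Vertex := fun τ x =>
    ⟨x.1, equivShrink _ (componentUnder (τ.fS x.1) (Y.vComp x))⟩
  let fB : (Y ⟶ Y) → Y.fibreData.total.Branch → Y.fibreData.total.Branch := fun τ β =>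
    ⟨β.1, equivShrink _ (componentUnder (τ.fT (𝒢.graph.edgeOf β.1)) (Y.brComp β))⟩
  let fE : (Y ⟶ Y) → Y.fibreData.total.Edge → Y.fibreData.total.Edge := fun τ ec =>
    ⟨ec.1, equivShrink _ (componentUnder (τ.fT ec.1) (Y.eComp ec))⟩
  have hfE : ∀ τ β, Y.fibreData.total.edgeOf (fB τ β) = fE τ (Y.fibreData.total.edgeOf β) := fun _ _ => rfl
  have hfP : ∀ τ, τ ≫ g = g → ∀ β : Y.fibreData.total.Branch, P (Y.fibreData.total.edgeOf β) →
      P (Y.fibreData.total.edgeOf (fB τ β)) := fun τ hτ β hβ => by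
    change (⟨𝒢.graph.edgeOf β.1, componentUnder (g.fT (𝒢.graph.edgeOf β.1)) (Y.brComp (fB τ β))⟩ :
      Σ e, π₀Obj (A.T e)) = ⟨e, Q⟩
    rw [Y.cellMap_over g τ hτ β]
    exact hβ
  -- transitivity of `Aut_A(Y)` on the allowed edge-cells (brick (b) at `ρ_e`)
  have hnf : ∀ ec : Y.fibreData.total.Edge, P ec →
      ∃ c : π₀Obj (Y.T e), componentUnder (g.fT e) c = Q ∧ ec = ⟨e, equivShrink _ c⟩ := by
    rintro ⟨e₁, c₁⟩ hP1
    obtain ⟨he1, hc1⟩ := Sigma.mk.inj_iff.mp hP1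
    change e₁ = e at he1
    subst he1
    exact ⟨_, eq_of_heq hc1, Sigma.ext rfl (heq_of_eq ((equivShrink _).apply_symm_apply c₁).symm)⟩
  let FD := GaloisCategory.getFiberFunctor (𝒢.E e)
  haveI : FiberFunctor (𝒢.ρE e ⋙ FD) := 𝒢.fiberFunctor_ρE h𝒢 e FD
  have htransE : ∀ ec₁ ec₂ : Y.fibreData.total.Edge, P ec₁ → P ec₂ →
      ∃ τ : Y ≅ Y, τ.hom ≫ g = g ∧ fE τ.hom ec₁ = ec₂ := by
    intro ec₁ ec₂ hP1 hP2
    obtain ⟨c₁, hc₁, rfl⟩ := hnf ec₁ hP1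
    obtain ⟨c₂, hc₂, rfl⟩ := hnf ec₂ hP2
    obtain ⟨τ, hτ, hc⟩ := exists_iso_over_componentUnder_eq (𝒢.ρE e) FD g c₁ c₂ (hc₁.trans hc₂.symm)
    refine ⟨τ, hτ, ?_⟩
    change (⟨e, equivShrink _ (componentUnder (τ.hom.fT e)
      ((equivShrink _).symm (equivShrink _ c₁)))⟩ : Y.fibreData.total.Edge) = _
    rw [Equiv.symm_apply_apply]
    exact congrArg (fun c => (⟨e, equivShrink _ c⟩ : Y.fibreData.total.Edge)) hc
  -- the finite set `W` of ends of allowed branch-cells; allowed degree ≥ 2 on it by transport under `Aut_A(Y)`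
  have hv₀ : 𝒢.graph.abuts β₀.1 = some x₀.1 := abuts_fst hx₀; have hv₁ : 𝒢.graph.abuts β₁.1 = some x₁.1 := abuts_fst hx₁
  haveI : ∀ v, Finite (Shrink.{u} (π₀Obj (Y.S v))) := fun v => Finite.of_equiv _ (equivShrink _)
  have hWfin : Set.Finite {x : Y.fibreData.total.Vertex |
      ∃ β : Y.fibreData.total.Branch, P (Y.fibreData.total.edgeOf β) ∧ Y.fibreData.total.abuts β = some x} := by
    refine ((Set.finite_range fun p : Shrink.{u} (π₀Obj (Y.S x₀.1)) => (⟨x₀.1, p⟩ : Y.fibreData.total.Vertex)).union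
      (Set.finite_range fun p : Shrink.{u} (π₀Obj (Y.S x₁.1)) => (⟨x₁.1, p⟩ : Y.fibreData.total.Vertex))).subset ?_
    rintro ⟨v, p⟩ ⟨β, hβ, hx⟩
    have hbx : 𝒢.graph.abuts β.1 = some v := abuts_fst hx
    rcases hbase β hβ with h | h <;> rw [h] at hbx
    · obtain rfl := Option.some_injective _ (hv₀.symm.trans hbx); exact Or.inl ⟨p, rfl⟩
    · obtain rfl := Option.some_injective _ (hv₁.symm.trans hbx); exact Or.inr ⟨p, rfl⟩
  have hWmem : ∀ x, x ∈ hWfin.toFinset ↔ ∃ β : Y.fibreData.total.Branch,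
      P (Y.fibreData.total.edgeOf β) ∧ Y.fibreData.total.abuts β = some x := fun x => by
    rw [Set.Finite.mem_toFinset]; rfl
  have hside : ∀ γ γ' : Y.fibreData.total.Branch, P (Y.fibreData.total.edgeOf γ) →
      P (Y.fibreData.total.edgeOf γ') → γ' ≠ γ → Y.fibreData.total.abuts γ' = Y.fibreData.total.abuts γ →
      ∀ (β : Y.fibreData.total.Branch) (x : Y.fibreData.total.Vertex), P (Y.fibreData.total.edgeOf β) →
      Y.fibreData.total.abuts β = some x → β.1 = γ.1 →
      ∃ b b' : Y.fibreData.total.Branch, b ≠ b' ∧ P (Y.fibreData.total.edgeOf b) ∧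
        P (Y.fibreData.total.edgeOf b') ∧ Y.fibreData.total.abuts b = some x ∧ Y.fibreData.total.abuts b' = some x := by
    intro γ γ' hγ hγ' hne hγa β x hβ hβx hβγ
    obtain ⟨τ, hτg, hτe⟩ := htransE _ _ hγ hβ
    have hγβ : fB τ.hom γ = β := Y.fibreData.proj.branchMap_injOn _ _ ((hfE τ.hom γ).trans hτe) hβγ.symm
    obtain ⟨xγ, hxγ⟩ := hPabuts γ hγ
    have h1 := Y.total_abuts_cellMap τ.hom γ xγ hxγ
    have h2 := Y.total_abuts_cellMap τ.hom γ' xγ (hγa.trans hxγ)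
    change Y.fibreData.total.abuts (fB τ.hom γ) = some (fV τ.hom xγ) at h1
    rw [hγβ, hβx] at h1
    refine ⟨β, fB τ.hom γ', ?_, hβ, hfP τ.hom hτg γ' hγ', hβx, h2.trans h1.symm⟩
    rw [← hγβ]; exact fun h => hne (Y.cellMap_branch_injective τ.hom h).symm
  -- the twin of `β₀` and its end
  obtain ⟨bc₁, hne, hebc⟩ : ∃ bc₁ : Y.fibreData.total.Branch,
      bc₁ ≠ β₀ ∧ Y.fibreData.total.edgeOf bc₁ = Y.fibreData.total.edgeOf β₀ := by
    obtain ⟨c₁, c₂, h12, hc₁, hc₂, hall⟩ := Y.fibreData.total.two_branches (Y.fibreData.total.edgeOf β₀)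
    rcases hall β₀ rfl with rfl | rfl
    exacts [⟨c₂, h12.symm, hc₂⟩, ⟨c₁, h12, hc₁⟩]
  have hbc₁ : bc₁.1 = β₁.1 := (hbase bc₁ (hebc ▸ hP₀)).resolve_left
    fun h => hne (Y.fibreData.proj.branchMap_injOn _ _ hebc h)
  obtain ⟨y₁, hy₁⟩ : ∃ y, Y.fibreData.total.abuts bc₁ = some y := by
    apply Option.isSome_iff_exists.mp
    rw [Y.fibreData.total_abuts_isSome, hbc₁, ← Y.fibreData.total_abuts_isSome β₁]; exact ha₁
  have hwalk := Y.fibreData.total.nonseparating_of_two_branches_of_transitive P hWfin.toFinset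
    (fun β hβ => (hPabuts β hβ).imp fun x hx => ⟨(hWmem x).mpr ⟨β, hβ, hx⟩, hx⟩)
    (fun x hx => by
      obtain ⟨β, hβ, hβx⟩ := (hWmem x).mp hx
      rcases hbase β hβ with h | h
      · exact hside β₀ β₀' hP₀ hP₀' hne₀ ha₀' β x hβ hβx h
      · exact hside β₁ β₁' hP₁ hP₁' hne₁ ha₁' β x hβ hβx h)
    (fun b₁ b₂ hb₁ hb₂ => by
      obtain ⟨τ, -, hτe⟩ := htransE _ _ hb₁ hb₂
      exact ⟨fV τ.hom, fB τ.hom, fun β β' h => by rw [hfE, hfE, h],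
        fun β x hx => Y.total_abuts_cellMap τ.hom β x hx, Y.cellMap_branch_injective τ.hom,
        (hfE τ.hom b₁).trans hτe⟩)
    β₀ hP₀ hx₀ hy₁ hne hebc
  obtain ⟨k, hk⟩ := exists_factor_componentUnder (g.fT (𝒢.graph.edgeOf β₀.1)) (Y.brComp β₀)
  exact ⟨Y, IsGalois.toIsConnected, g, β₀, x₀, y₁, bc₁, hx₀, hy₁, hne, hebc, hwalk, _, hQ β₀ (by simp), k, hk⟩

end Literature.AnabelianGeometry.SemiGraphs.SemiGraphOfAnabelioids.BObj
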